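import Literature.NumberTheory.Automorphic.ClozelPurityProofs
import HarnessLib

/-!
# Clozel's algebraicity theorem (Thm. 3.13): decomposition into its two printed assertions

Topic `Literature/NumberTheory/Automorphic`. SPLIT of the named fact
`Literature.NumberTheory.Automorphic.Clozel1990_regularAlgebraic` (`ClozelAlgebraicity.lean`;
L. Clozel, *Motifs et formes automorphes*, Ann Arbor 1988 (Academic Press 1990), Théorème 3.13 with
Lemme 4.9, read through Patrikis 2019, Thm. 3.2.1 and Cor. 3.2.3: a four-clause conjunction (i) `ℚ(π_f)`
is a number field, (ii) the cuspidal `Aut(ℂ)`-conjugates `^σπ` exist with infinity types `^σT`,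
(iii) archimedean purity, (iv) `ℚ(π_f)` totally real or CM).  In the tree clause (iii) is a THEOREM
(`CuspidalAutomorphicRepData.purity`, `ClozelPurityProofs.lean`: the Petersson form and the
Hermitian symmetry of the archimedean parameter) and clause (iv) FOLLOWS from (i)–(iii)
(`Clozel1990_regularAlgebraic_of_clauses`, `ClozelAlgebraicityCMAssemblyProofs.lean`: Patrikis's
argument `π^∨ ≅ ^cπ ⇒ ^{cσ}π ≅ ^{σc}π`), so the fact follows from clauses (i) and (ii) alone
(`Clozel1990_regularAlgebraic_of_clauses_i_ii`) — the two assertions of Clozel's Théorème 3.13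
proper, which are the children:

* `Clozel1990_ratField_numberField` — "`ℚ(π_f)` is in fact a number field for `π` C-algebraic
  [regular]" (finiteness of the `Aut(ℂ)`-orbit of `π_f`);
* `Clozel1990_exists_autConjugate` — "for each `σ ∈ Aut(ℂ)` there is a cuspidal representation `^σπ`
  with finite part `^σπ_f = π_f ⊗_{ℂ,σ} ℂ` and with infinity type `^σM`" (`Aut(ℂ)`-stability of the
  set of cuspidal regular algebraic representations, on the tree's carriers: `IsAutConjugate` on the
  unramified Hecke eigenvalues, `InfinityType.autConj` on the `a`-multisets);

and the PROVED assembly `Clozel1990_regularAlgebraic_holds_of`.  Both children rest, in print, on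
the `ℚ`-structure of cuspidal cohomology (Clozel §3.5 with Lemme 3.14 and Franke's theorem;
Grobner–Raghuram 2014 §§7–8), of which the tree has the formal last step
(`ClozelAlgebraicityHeckeFieldProofs.lean`), Lemme 3.14 on multisets
(`ClozelCohomologicalTypeProofs.lean`) and, over `ℚ` only, the carrier `GLnCohomology.levelCohomology`
with the named fact `GLnCohomology.cuspidalEigenclass_exists` (`CuspidalCohomologyGL.lean`).

## References

* L. Clozel, *Motifs et formes automorphes: applications du principe de fonctorialité*, in
  Automorphic forms, Shimura varieties, and L-functions I (Ann Arbor 1988), Academic Press 1990: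
  Thm. 3.13, Lemme 3.14, §3.5, Lemme 4.9. [Clozel1990]
* S. Patrikis, *Variations on a theorem of Tate*, Mem. AMS 258 (2019) no. 1238 = arXiv:1207.6724:
  Thm. 3.2.1, Cor. 3.2.3. [Patrikis2019]
-/

noncomputable section

open scoped Classical
open NumberField IsDedekindDomain

namespace Literature.NumberTheory.Automorphic

/-! ## The children (named facts) -/

/-- NAMED FACT (Clozel 1990, Thm. 3.13, first assertion: the rationality field is a number field).
For every number field `K`, every `n` and every cuspidal automorphic representation `π` of
`GL_n(𝔸_K)` that is regular algebraic (`IsRegularAlgebraic`: C-algebraic and regular), the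
rationality field `ℚ(π_f) = ratField π` — the fixed field in `ℂ` of the stabiliser in `Aut(ℂ)` of the
unramified Hecke eigensystem of `π` at almost all places (`heckeStabilizer`) — is finite over `ℚ`.
Print (Patrikis, Thm. 3.2.1 = Clozel Thm. 3.13): "`π_f` has a model over the fixed field
`ℚ(π_f) ⊂ ℚ̄ ⊂ ℂ` of all automorphisms `σ ∈ Aut(ℂ)` such that `^σπ_f ≅ π_f`, with `ℚ(π_f)` in fact a
number field for `π` C-algebraic" (proof: `π_f` occurs in the cuspidal cohomology of the adelic
locally symmetric space with coefficients in `E_μ`, a finite-dimensional space with a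
`ℚ(μ)`-structure preserved by the integral Hecke operators, Clozel §3.5). Clause (i) of
`Clozel1990_regularAlgebraic` verbatim. Users take `(h : Clozel1990_ratField_numberField)`.
[cite: Clozel1990, Thm. 3.13 (ℚ(π_f) is a number field)] [cite: Patrikis2019, Thm. 3.2.1 (arXiv:1207.6724 §3.2)] -/
def Clozel1990_ratField_numberField : Prop :=
  ∀ (n : ℕ) (K : Type) [Field K] [NumberField K] (hcpt : isCompact_glFiniteIntegralLevel n K)
    (π : CuspidalAutomorphicRepData n K hcpt), π.1.IsRegularAlgebraic →
    FiniteDimensional ℚ (ratField π.1)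

/-- NAMED FACT (Clozel 1990, Thm. 3.13, second assertion: the `Aut(ℂ)`-conjugates). For every
number field `K`, every `n`, every cuspidal regular algebraic `π` on `GL_n(𝔸_K)` and every
`σ ∈ Aut(ℂ)` there is a CUSPIDAL `π'` on `GL_n(𝔸_K)` which is the `σ`-conjugate of `π` at almost
all finite places (`IsAutConjugate σ π π'`: unramified Hecke eigenvalues `t_{v,i}(π') = σ(t_{v,i}(π))`)
and whose archimedean parameter is that of the conjugate type: for every regular algebraic infinity
type `T` of `π`, some infinity type `T'` of `π'` has at every embedding `ι` the `a`-multiset of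
`^σT = T.autConj σ` (`^σM = (μ_{σ⁻¹ι})_ι`). Print (Patrikis, Thm. 3.2.1 = Clozel Thm. 3.13): "For
each `σ ∈ Aut(ℂ)` there is a cuspidal representation `^σπ` with finite part `^σπ_f = π_f ⊗_{ℂ,σ} ℂ`
and with infinity-type `^σM`" (proof: `σ`-linear transport of structure on cuspidal cohomology with
coefficients in `E_μ` and `^σE_μ`, Clozel §3.5). Clause (ii) of `Clozel1990_regularAlgebraic`
verbatim. Users take `(h : Clozel1990_exists_autConjugate)`.
[cite: Clozel1990, Thm. 3.13 (existence of ^σπ)] [cite: Patrikis2019, Thm. 3.2.1 (arXiv:1207.6724 §3.2)] -/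
def Clozel1990_exists_autConjugate : Prop :=
  ∀ (n : ℕ) (K : Type) [Field K] [NumberField K] (hcpt : isCompact_glFiniteIntegralLevel n K)
    (π : CuspidalAutomorphicRepData n K hcpt), π.1.IsRegularAlgebraic →
    ∀ σ : ℂ ≃ₐ[ℚ] ℂ, ∃ π' : CuspidalAutomorphicRepData n K hcpt,
      IsAutConjugate σ π.1 π'.1 ∧
      ∀ T : InfinityType K n, π.1.HasInfinityType T → T.IsRegularAlgebraic →
        ∃ T' : InfinityType K n, π'.1.HasInfinityType T' ∧
          ∀ ι : K →+* ℂ, (T' ι).map ArchWeight.a = (T.autConj σ ι).map ArchWeight.a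

/-! ## The assembly (proved) -/

/-- **Clozel's four-clause algebraicity fact from the two assertions of Thm. 3.13 (SPLIT
assembly).** `Clozel1990_ratField_numberField → Clozel1990_exists_autConjugate →
Clozel1990_regularAlgebraic`, by `Clozel1990_regularAlgebraic_of_clauses_i_ii` (purity, clause
(iii), is the theorem `CuspidalAutomorphicRepData.purity`; the CM property, clause (iv), follows by
Patrikis's argument, `Clozel1990_regularAlgebraic_of_clauses`).
[cite: Clozel1990, Thm. 3.13 and Lemme 4.9] [cite: Patrikis2019, Cor. 3.2.3] -/
theorem Clozel1990_regularAlgebraic_holds_of (h₁ : Clozel1990_ratField_numberField)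
    (h₂ : Clozel1990_exists_autConjugate) : Clozel1990_regularAlgebraic :=
  Clozel1990_regularAlgebraic_of_clauses_i_ii fun n K _ _ hcpt π hπ =>
    ⟨h₁ n K hcpt π hπ, h₂ n K hcpt π hπ⟩

end Literature.NumberTheory.Automorphic
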